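import Mathlib
import HarnessLib
import Summits.HubbardSuperconductivity.HubbardSuperconductivity.Theorems.KLProgrammeKLRegimeEnginePairTransferMemberFlow
import Summits.HubbardSuperconductivity.HubbardSuperconductivity.Theorems.KLProgrammeKLRegimeSplitEdgeFactsRungProfile

/-!
# Route `KLProgramme` — ENGINE child gen 8 (stmt-HubbardSuperconductivity-20437 `KLRegimeEngineV17F2`), skeleton v2 class #5 rev 3:
# the INTEGRATED RATE PROFILE of a member's rung weight is below the rung profile — `klmf_integral_norm_rate_le_klRungProfile`
# (cell gate-hubbard-kl, seat hubbard-kl-k3c1-p1 g15, technique «composed-map remainder propagation»; row 57 of CLASS5-RESOLVED-STEP.md)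

WHY.  The resolved class-#5 STEP door `kltc_relative_flow_duhamel_resolved_of_rates` (`…EnginePairLadderRelativeFlowRates`) asks, per member `ψ` of the pair
and per loop label `c`, the INTEGRATED RATE PROFILE `∫₀¹‖ḃ(τ,c)‖dτ ≤ V(c)` of the rung weight `b(t) = −B(φ_t, φ_t)(Qm,·)` along the slice `n+1`
(`φ_t = ψ + (w_{Λₙ₊₁} − w_{Λ(t)})`, `ḃ = (Λₙ₊₁ − Λₙ)·(B(∂_Λw, φ_t) + B(φ_t, ∂_Λw))`, `klmf_rung_data`), with `m·Σ_c V(c) ≤ 1/3`.  The rung weight is NOT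
monotone in `t` in general (the pair sum has a sign only on the hard/deep-pair zone), but its RATE integrates against the profile of record:
`∂_Λ w^K_Λ(k) = χ₂′((ω²+e²)/Λ²)·(−2(ω²+e²)/Λ³) ≤ 0` (`monotone_salmhoferCutoff`), so `τ ↦ w_{Λ(τ)}(k)` is monotone along the slice and
`∫₀¹ (Λₙ − Λₙ₊₁)|∂_Λ w(Λ(τ),k)|dτ = w_{Λₙ₊₁}(k) − w_{Λₙ}(k) = s_{n,n+1}(k)` (FTC); with `|B(a,b)| ≤ Maj(a,b)` (`abs_klBubbleMass_le_klBubbleMaj`), `|φ_τ| ≤ φ₀ = ψ + s`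
(`runningSlice_mem`) and the linearity of `klBubbleMaj` in each |weight|:
  **`∫₀¹‖ḃ(τ,c)‖dτ ≤ Maj(s, φ₀)(c) + Maj(φ₀, s)(c) ≤ klRungProfile … n ψ Qm c`**
— so the resolved STEP is keyed on EXACTLY the profile rows (`klRungProfile`, `sum_klRungProfile_compl_le`, windowed masses `sum_window_klRungProfile_le`) that the
STEP of record already discharges.  Real analysis over landed model lemmas; nothing asserts (X).3, (c), K3 or superconductivity.  0 kit · 0 lit.
-/

noncomputable section

namespace Summit.HubbardSuperconductivity.HubbardSuperconductivity.Theorems.KLRegimeSplit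

set_option linter.dupNamespace false -- summit = problem name (single-conjunct summit), D-0017

open Finset Set Literature.MathematicalPhysics.QuantumLattice Literature.Probability.LatticeModels
open Summit.HubbardSuperconductivity.HubbardSuperconductivity.Theorems.KLProgrammeLegKernels
open Summit.HubbardSuperconductivity.HubbardSuperconductivity.Theorems.DispersionFlow
open Summit.HubbardSuperconductivity.HubbardSuperconductivity.Theorems.KLRegimeWick

section RateVariation

variable {L M : ℕ} [NeZero L] (β μ : ℝ) (K : TrigPolyC4v)

/-- `χ₂′ ≥ 0` (the Salmhofer cutoff is monotone and differentiable). -/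
theorem klrv_deriv_salmhoferCutoff_nonneg (x : ℝ) : 0 ≤ deriv salmhoferCutoff x :=
  (hasDerivAt_salmhoferCutoff x).nonneg_of_monotone monotone_salmhoferCutoff

omit [NeZero L] in
/-- **The cutoff weight is antitone in the cutoff**: `∂_Λ w^K_Λ(k) ≤ 0` for `0 < Λ`. -/
theorem klrv_deriv_cutoffWeight_nonpos {Λ : ℝ} (hΛ : 0 < Λ) (k : FreqMomentum L M) :
    deriv (fun Λ' : ℝ => hubbardCutoffWeightCT L M β μ K Λ' k) Λ ≤ 0 := by
  rw [klws_deriv_cutoffWeight_scale_eq L M β μ K hΛ.ne' k]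
  have h1 := klrv_deriv_salmhoferCutoff_nonneg ((matsubaraFreq β M k.1 ^ 2 + nambuXiCT L μ K k.2 ^ 2) / Λ ^ 2)
  have hE : 0 ≤ matsubaraFreq β M k.1 ^ 2 + nambuXiCT L μ K k.2 ^ 2 := by positivity
  have h2 : -(2 * (matsubaraFreq β M k.1 ^ 2 + nambuXiCT L μ K k.2 ^ 2)) / Λ ^ 3 ≤ 0 :=
    div_nonpos_of_nonpos_of_nonneg (by linarith) (by positivity)
  exact mul_nonpos_of_nonneg_of_nonpos h1 h2

omit [NeZero L] in
/-- **Total variation of the running cutoff weight along slice `n+1`**: with `Λ(τ) = Λₙ + τ(Λₙ₊₁ − Λₙ)`,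
`∫₀¹ |(Λₙ₊₁ − Λₙ)·∂_Λ w(Λ(τ),k)| dτ = w_{Λₙ₊₁}(k) − w_{Λₙ}(k) = s^K_{n,n+1}(k)` (monotonicity + FTC). -/
theorem klrv_integral_abs_runningWeight_deriv (n : ℕ) (k : FreqMomentum L M) :
    (∫ τ in (0 : ℝ)..1, |(klScale klE0 (n + 1) - klScale klE0 n) *
        deriv (fun Λ' : ℝ => hubbardCutoffWeightCT L M β μ K Λ' k) (klScale klE0 n + τ * (klScale klE0 (n + 1) - klScale klE0 n))|) =
      softSymbolCompl L M β μ K n (n + 1) k := by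
  have h10 := klmf_klScale_succ_pos_le n
  set Λt : ℝ → ℝ := fun τ => klScale klE0 n + τ * (klScale klE0 (n + 1) - klScale klE0 n) with hΛt
  have hpos : ∀ τ ∈ Icc (0 : ℝ) 1, 0 < Λt τ := fun τ hτ => h10.1.trans_le (klws_affine_mem_Icc h10.2 hτ).1
  -- the running weight and its derivative along the path
  set g : ℝ → ℝ := fun τ => hubbardCutoffWeightCT L M β μ K (Λt τ) k with hg
  set g' : ℝ → ℝ := fun τ => deriv (fun Λ' : ℝ => hubbardCutoffWeightCT L M β μ K Λ' k) (Λt τ) * (klScale klE0 (n + 1) - klScale klE0 n)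
    with hg'
  have hderiv : ∀ τ ∈ uIcc (0 : ℝ) 1, HasDerivAt g (g' τ) τ := by
    intro τ hτ
    rw [Set.uIcc_of_le zero_le_one] at hτ
    have hf := (klws_hasDerivAt_cutoffWeight_scale L M β μ K (hpos τ hτ).ne' k).differentiableAt.hasDerivAt
    exact hf.comp τ (klws_hasDerivAt_affine (klScale klE0 n) (klScale klE0 (n + 1)) τ)
  have hg'c : ContinuousOn g' (uIcc (0 : ℝ) 1) := by
    intro τ hτ
    rw [Set.uIcc_of_le zero_le_one] at hτ
    have h := (klws_continuousAt_derivCutoffWeight_scale L M β μ K (hpos τ hτ).ne' k).comp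
      (f := Λt) (klws_hasDerivAt_affine (klScale klE0 n) (klScale klE0 (n + 1)) τ).continuousAt
    exact (h.mul continuousAt_const).continuousWithinAt
  -- the integrand is `g'` (both factors nonpositive)
  have heq : ∀ τ ∈ uIcc (0 : ℝ) 1, |(klScale klE0 (n + 1) - klScale klE0 n) *
      deriv (fun Λ' : ℝ => hubbardCutoffWeightCT L M β μ K Λ' k) (klScale klE0 n + τ * (klScale klE0 (n + 1) - klScale klE0 n))| = g' τ := by
    intro τ hτ
    rw [Set.uIcc_of_le zero_le_one] at hτ
    have hd := klrv_deriv_cutoffWeight_nonpos β μ K (hpos τ hτ) k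
    have hΔ : klScale klE0 (n + 1) - klScale klE0 n ≤ 0 := by linarith [h10.2]
    rw [hg', abs_of_nonneg (mul_nonneg_of_nonpos_of_nonpos hΔ hd), mul_comm]
  rw [intervalIntegral.integral_congr heq, intervalIntegral.integral_eq_sub_of_hasDerivAt hderiv hg'c.intervalIntegrable]
  simp only [hg, hΛt, softSymbolCompl, one_mul, zero_mul, add_zero, add_sub_cancel]

omit [NeZero L] in
/-- Scaling of the bubble majorant in the first weight. -/
theorem klrv_klBubbleMaj_smul_left (r : ℝ) (a b : FreqMomentum L M → ℝ) (Qm c : TorusSite 2 L) :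
    klBubbleMaj L M β μ K (fun k => r * a k) b Qm c = |r| * klBubbleMaj L M β μ K a b Qm c := by
  unfold klBubbleMaj
  simp only [abs_mul, mul_sum]
  exact sum_congr rfl fun ν _ => by ring

omit [NeZero L] in
/-- Scaling of the bubble majorant in the second weight. -/
theorem klrv_klBubbleMaj_smul_right (r : ℝ) (a b : FreqMomentum L M → ℝ) (Qm c : TorusSite 2 L) :
    klBubbleMaj L M β μ K a (fun k => r * b k) Qm c = |r| * klBubbleMaj L M β μ K a b Qm c := by
  unfold klBubbleMaj
  simp only [abs_mul, mul_sum]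
  exact sum_congr rfl fun ν _ => by ring

omit [NeZero L] in
/-- **Integration of the bubble majorant in the first weight**: if `∫₀¹|a(τ,k)|dτ = |A(k)|` for every label (and the integrands are integrable), then
`∫₀¹ Maj(a(τ), b)(c) dτ = Maj(A, b)(c)`. -/
theorem klrv_integral_klBubbleMaj_left (a : ℝ → FreqMomentum L M → ℝ) (A b : FreqMomentum L M → ℝ) (Qm c : TorusSite 2 L)
    (hint : ∀ k, IntervalIntegrable (fun τ => |a τ k|) MeasureTheory.volume 0 1) (hA : ∀ k, (∫ τ in (0 : ℝ)..1, |a τ k|) = |A k|) :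
    (∫ τ in (0 : ℝ)..1, klBubbleMaj L M β μ K (a τ) b Qm c) = klBubbleMaj L M β μ K A b Qm c := by
  unfold klBubbleMaj
  rw [intervalIntegral.integral_const_mul]
  congr 1
  rw [intervalIntegral.integral_finsetSum fun ν _ => ((hint (ν, c)).mul_const _).mul_const _]
  refine sum_congr rfl fun ν _ => ?_
  rw [intervalIntegral.integral_mul_const, intervalIntegral.integral_mul_const, hA]

omit [NeZero L] in
/-- **Integration of the bubble majorant in the second weight.** -/
theorem klrv_integral_klBubbleMaj_right (a : ℝ → FreqMomentum L M → ℝ) (A b : FreqMomentum L M → ℝ) (Qm c : TorusSite 2 L)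
    (hint : ∀ k, IntervalIntegrable (fun τ => |a τ k|) MeasureTheory.volume 0 1) (hA : ∀ k, (∫ τ in (0 : ℝ)..1, |a τ k|) = |A k|) :
    (∫ τ in (0 : ℝ)..1, klBubbleMaj L M β μ K b (a τ) Qm c) = klBubbleMaj L M β μ K b A Qm c := by
  unfold klBubbleMaj
  rw [intervalIntegral.integral_const_mul]
  congr 1
  rw [intervalIntegral.integral_finsetSum fun ν _ => (((hint (ν.rev, Qm - c)).mul_const _).const_mul _)]
  refine sum_congr rfl fun ν _ => ?_
  rw [intervalIntegral.integral_const_mul, intervalIntegral.integral_mul_const, hA]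

omit [NeZero L] in
set_option maxHeartbeats 400000 in -- long model expressions (the rung rate of `klmf_rung_data`); pre-empts the 180k cliff probe
/-- **The integrated rate profile of a member's rung weight is below the rung profile** (row 57 of CLASS5-RESOLVED-STEP): for `0 < β`, `ψ ≥ 0`, every pair class
`Qm`, loop label `c`, and the rung rate `ḃ` of `klmf_rung_data` along slice `n+1`,
`∫₀¹ ‖ḃ(τ,c)‖ dτ ≤ klRungProfile … n ψ Qm c` — the `V`-row of `kltc_relative_flow_duhamel_resolved_of_rates` with `V := klRungProfile`. -/
theorem klmf_integral_norm_rate_le_klRungProfile [NeZero M] (hβ : 0 < β) (n : ℕ) {ψ : FreqMomentum L M → ℝ} (hψ : ∀ k, 0 ≤ ψ k)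
    (Qm c : TorusSite 2 L) (b' : ℝ → TorusSite 2 L → ℂ)
    (hb'def : b' = fun t p => (((klScale klE0 (n + 1) - klScale klE0 n) *
        (klBubbleMass L M β μ K
            (fun k => deriv (fun Λ' => hubbardCutoffWeightCT L M β μ K Λ' k) (klScale klE0 n + t * (klScale klE0 (n + 1) - klScale klE0 n)))
            (fun k => ψ k + (hubbardCutoffWeightCT L M β μ K (klScale klE0 (n + 1)) k -
              hubbardCutoffWeightCT L M β μ K (klScale klE0 n + t * (klScale klE0 (n + 1) - klScale klE0 n)) k)) Qm p +
          klBubbleMass L M β μ K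
            (fun k => ψ k + (hubbardCutoffWeightCT L M β μ K (klScale klE0 (n + 1)) k -
              hubbardCutoffWeightCT L M β μ K (klScale klE0 n + t * (klScale klE0 (n + 1) - klScale klE0 n)) k))
            (fun k => deriv (fun Λ' => hubbardCutoffWeightCT L M β μ K Λ' k) (klScale klE0 n + t * (klScale klE0 (n + 1) - klScale klE0 n)))
            Qm p) : ℝ) : ℂ)) :
    (∫ τ in (0 : ℝ)..1, ‖b' τ c‖) ≤ klRungProfile L M β μ K n ψ Qm c := by
  have h10 := klmf_klScale_succ_pos_le n
  -- names
  set s : FreqMomentum L M → ℝ := softSymbolCompl L M β μ K n (n + 1) with hs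
  set φ₀ : FreqMomentum L M → ℝ := fun k => ψ k + softSymbolCompl L M β μ K n (n + 1) k with hφ₀
  set Λt : ℝ → ℝ := fun τ => klScale klE0 n + τ * (klScale klE0 (n + 1) - klScale klE0 n) with hΛt
  have hpos : ∀ τ ∈ Icc (0 : ℝ) 1, 0 < Λt τ := fun τ hτ => h10.1.trans_le (klws_affine_mem_Icc h10.2 hτ).1
  set wd : ℝ → FreqMomentum L M → ℝ := fun τ k => deriv (fun Λ' : ℝ => hubbardCutoffWeightCT L M β μ K Λ' k) (Λt τ) with hwd
  set φ : ℝ → FreqMomentum L M → ℝ := fun τ k => ψ k + (hubbardCutoffWeightCT L M β μ K (klScale klE0 (n + 1)) k -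
    hubbardCutoffWeightCT L M β μ K (Λt τ) k) with hφ
  set a : ℝ → FreqMomentum L M → ℝ := fun τ k => (klScale klE0 (n + 1) - klScale klE0 n) * wd τ k with ha
  -- the symbol along the path sits between `ψ` and `φ₀`
  have hs0 : ∀ k, 0 ≤ s k := fun k => by
    have h := runningSlice_mem (L := L) (M := M) β μ K n (show (1 : ℝ) ∈ Icc (0 : ℝ) 1 from ⟨zero_le_one, le_rfl⟩) k
    simp only [one_mul, add_sub_cancel] at h
    simpa [hs, softSymbolCompl] using h.1
  have hφ_abs : ∀ τ ∈ Icc (0 : ℝ) 1, ∀ k, |φ τ k| ≤ |φ₀ k| := by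
    intro τ hτ k
    obtain ⟨h0, h1⟩ := runningSlice_mem (L := L) (M := M) β μ K n hτ k
    have hsk := hs0 k
    simp only [hs, softSymbolCompl] at hsk h1
    have hlo : 0 ≤ φ τ k := by simp only [hφ, hΛt]; linarith [hψ k]
    have hhi : φ τ k ≤ φ₀ k := by simp only [hφ, hφ₀, hΛt, softSymbolCompl]; linarith
    rw [abs_of_nonneg hlo, abs_of_nonneg (hlo.trans hhi)]
    exact hhi
  -- the pointwise bound `‖ḃ(τ,c)‖ ≤ Maj(a τ, φ₀) + Maj(φ₀, a τ)`
  have hpt : ∀ τ ∈ Icc (0 : ℝ) 1, ‖b' τ c‖ ≤ klBubbleMaj L M β μ K (a τ) φ₀ Qm c + klBubbleMaj L M β μ K φ₀ (a τ) Qm c := by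
    intro τ hτ
    have e : ‖b' τ c‖ = |(klScale klE0 (n + 1) - klScale klE0 n) *
        (klBubbleMass L M β μ K (wd τ) (φ τ) Qm c + klBubbleMass L M β μ K (φ τ) (wd τ) Qm c)| := by
      rw [hb'def]; simp only [hwd, hφ, hΛt, Complex.norm_real, Real.norm_eq_abs]
    rw [e, abs_mul]
    have h1 := abs_klBubbleMass_le_klBubbleMaj β μ K hβ (wd τ) (φ τ) Qm c
    have h2 := abs_klBubbleMass_le_klBubbleMaj β μ K hβ (φ τ) (wd τ) Qm c
    have hrefl : ∀ k, |wd τ k| ≤ |wd τ k| := fun _ => le_rfl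
    have h1' := h1.trans (klBubbleMaj_mono β μ K hβ hrefl (hφ_abs τ hτ) Qm c)
    have h2' := h2.trans (klBubbleMaj_mono β μ K hβ (hφ_abs τ hτ) hrefl Qm c)
    have hscale₁ : klBubbleMaj L M β μ K (a τ) φ₀ Qm c = |klScale klE0 (n + 1) - klScale klE0 n| * klBubbleMaj L M β μ K (wd τ) φ₀ Qm c := by
      simp only [ha]; exact klrv_klBubbleMaj_smul_left β μ K _ _ _ Qm c
    have hscale₂ : klBubbleMaj L M β μ K φ₀ (a τ) Qm c = |klScale klE0 (n + 1) - klScale klE0 n| * klBubbleMaj L M β μ K φ₀ (wd τ) Qm c := by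
      simp only [ha]; exact klrv_klBubbleMaj_smul_right β μ K _ _ _ Qm c
    rw [hscale₁, hscale₂, ← mul_add]
    exact mul_le_mul_of_nonneg_left ((abs_add_le _ _).trans (add_le_add h1' h2')) (abs_nonneg _)
  -- continuity / integrability along the path
  have hwd_c : ∀ k, ContinuousOn (fun τ => a τ k) (uIcc (0 : ℝ) 1) := by
    intro k τ hτ
    rw [Set.uIcc_of_le zero_le_one] at hτ
    have h := (klws_continuousAt_derivCutoffWeight_scale L M β μ K (hpos τ hτ).ne' k).comp
      (f := Λt) (klws_hasDerivAt_affine (klScale klE0 n) (klScale klE0 (n + 1)) τ).continuousAt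
    exact (continuousAt_const.mul h).continuousWithinAt
  have hint : ∀ k, IntervalIntegrable (fun τ => |a τ k|) MeasureTheory.volume 0 1 := fun k => (hwd_c k).abs.intervalIntegrable
  have hA : ∀ k, (∫ τ in (0 : ℝ)..1, |a τ k|) = |s k| := fun k => by
    rw [abs_of_nonneg (hs0 k)]
    exact klrv_integral_abs_runningWeight_deriv β μ K n k
  have hMaj_c : ∀ (u : FreqMomentum L M → ℝ), ContinuousOn (fun τ => klBubbleMaj L M β μ K (a τ) u Qm c + klBubbleMaj L M β μ K u (a τ) Qm c)
      (uIcc (0 : ℝ) 1) := by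
    intro u
    simp only [klBubbleMaj]
    refine (continuousOn_const.mul (continuousOn_finsetSum _ fun ν _ => ?_)).add
      (continuousOn_const.mul (continuousOn_finsetSum _ fun ν _ => ?_))
    · exact (((hwd_c (ν, c)).abs.mul continuousOn_const).mul continuousOn_const)
    · exact (continuousOn_const.mul ((hwd_c (ν.rev, Qm - c)).abs.mul continuousOn_const))
  have hb'c : ContinuousOn (fun τ => ‖b' τ c‖) (uIcc (0 : ℝ) 1) := by
    rw [Set.uIcc_of_le zero_le_one]
    obtain ⟨-, hcont, -⟩ := klmf_rung_data L M β μ K n ψ Qm _ b' rfl hb'def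
    exact (hcont c).norm
  -- integrate
  have hmono : (∫ τ in (0 : ℝ)..1, ‖b' τ c‖) ≤
      ∫ τ in (0 : ℝ)..1, (klBubbleMaj L M β μ K (a τ) φ₀ Qm c + klBubbleMaj L M β μ K φ₀ (a τ) Qm c) :=
    intervalIntegral.integral_mono_on zero_le_one hb'c.intervalIntegrable (hMaj_c φ₀).intervalIntegrable fun τ hτ => hpt τ hτ
  have hMaj₁ : IntervalIntegrable (fun τ => klBubbleMaj L M β μ K (a τ) φ₀ Qm c) MeasureTheory.volume 0 1 := by
    refine ContinuousOn.intervalIntegrable ?_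
    simp only [klBubbleMaj]
    exact continuousOn_const.mul (continuousOn_finsetSum _ fun ν _ => ((hwd_c (ν, c)).abs.mul continuousOn_const).mul continuousOn_const)
  have hMaj₂ : IntervalIntegrable (fun τ => klBubbleMaj L M β μ K φ₀ (a τ) Qm c) MeasureTheory.volume 0 1 := by
    refine ContinuousOn.intervalIntegrable ?_
    simp only [klBubbleMaj]
    exact continuousOn_const.mul (continuousOn_finsetSum _ fun ν _ =>
      continuousOn_const.mul ((hwd_c (ν.rev, Qm - c)).abs.mul continuousOn_const))
  rw [intervalIntegral.integral_add hMaj₁ hMaj₂, klrv_integral_klBubbleMaj_left β μ K a s φ₀ Qm c hint hA,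
    klrv_integral_klBubbleMaj_right β μ K a s φ₀ Qm c hint hA] at hmono
  refine hmono.trans ?_
  have h3 := klBubbleMaj_nonneg β μ K hβ s s Qm c
  simp only [klRungProfile, hs, hφ₀] at h3 ⊢
  linarith

end RateVariation

end Summit.HubbardSuperconductivity.HubbardSuperconductivity.Theorems.KLRegimeSplit

end
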